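import Summits.NavierStokesRegularity.FluidComputer.PalasekTowerGermHostTameCarrier
import Literature.Analysis.FluidPDE.SmallL3ClassicalSupBound

/-!
# The germ host — THE TAME CARRIER RUN: a strict-slot carrier whose FREE Navier–Stokes run stays under
# `2Y₀` on the whole first window (the carrier obligation of the superposition door, discharged)

Cell `ns-blowup`, seat `ns-blowup-ecbridge-3` (g8); GROUP C «BRIDGE SUPPORT» of the route
`PalasekTowerBreakdown` (crux `EpisodeBaseG`, item stmt-NavierStokesRegularity-19179, line `slot`).
Sequel of `PalasekTowerGermHostTameCarrier.lean` (tame carriers `tinyProfile a + λ • farPusher` of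
arbitrarily small `L³` size fill the strict slot `Germ.LevelZeroData`) and of the Literature theorem
`Literature.Analysis.FluidPDE.exists_classical_run_norm_le_two_mul_Icc` (Kato 1984 small `L³` data +
Leray 1934 short-time bound: a smooth compactly supported divergence-free datum with `|u₀| ≤ A` and
`‖u₀‖_{L³} ≤ c ν` has, on every slab, a classical finite-energy free run with `|u| ≤ 2A` throughout).
LABEL: E–C typing (KERNEL: theorems only). WHAT THIS IS NOT: not Navier–Stokes evidence about the crux —
an existence-with-sup-bound theorem for ONE designed small datum (speed `Y₀` at one point, scale-invariant
size as small as Kato's threshold demands); no amplifier run meeting the first-window letter is exhibited;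
nothing about `FirstEpisodeD`, `EpisodeBaseG`, `RungG 1` or blow-up.

## The result

* **`exists_levelZeroData_tame_freeRun`**: there is a strict-slot carrier `U` (`LevelZeroData U 7`) with a
  classical finite-energy FREE run `(v, q)` (`ν = 1`, zero force) on `[1, Host.τfirst]`, `v 1 = U`,
  obeying `‖v t x‖ ≤ 2 Y₀` for all `t ∈ [1, τfirst]` and all `x`;
* **`exists_levelZeroData_tame_freeRun_cap`**: hence, for every margin `η ≤ Y₁/3`, a carrier run under
  the cap `(5/3) Y₁ − η` of the superposition door (`2Y₀ ≤ Y₁ ≤ (4/3)Y₁`, `TowerRates.wide_sep`) — and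
  `η ≤ Y₁/3` is forced on any amplifier run that shows speed `≥ Y₁ + η` under the same cap.

So the hypothesis pair `(hv₁, hcap₁)` of `palasekTowerBreakdown_episodeBase_of_superposed_freeRuns`
(Theorems, p512842) is inhabited once and for all: `EpisodeBase ⇐ ONE amplifier free run` (Theorems sequel
`PalasekTowerBreakdownEpisodeBaseMechanismFreeRun.lean`).

References: T. Kato, Math. Z. 187 (1984) 471–480, Thm. 2–4 [cite: Kato1984, Thm. 2–4]; J. Leray, Acta
Math. 63 (1934), §19 (3.8), §21 (3.15) [cite: Leray1934, §19 (3.8) p. 223 and §21 (3.15) p. 226];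
S. Palasek, arXiv:2605.13827 §3.3–§4 [cite: Palasek2026ElementaryModel, §3.3].
-/

noncomputable section

namespace Summit.NavierStokesRegularity.FluidComputer.PalasekTowerClayBridge.Germ

open Set Function Filter Topology Metric MeasureTheory
open scoped Topology ContDiff ENNReal

open Literature.Analysis.FluidPDE

/-- `1 < τfirst` (the first window has positive length). [folklore] -/
theorem one_lt_τfirst : (1 : ℝ) < Host.τfirst := by
  rw [Host.τfirst_eq]; linarith [Host.wfirst_pos]

/-- **THE TAME CARRIER RUN.** There is a strict-slot carrier `U` (`LevelZeroData U 7` — a tame carrier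
`tinyProfile a + λ • farPusher` of `L³` size below Kato's threshold) with a classical finite-energy FREE
Navier–Stokes run `(v, q)` at unit viscosity on `[1, Host.τfirst]` from `v 1 = U` obeying
`‖v t x‖ ≤ 2 Y₀` for every `t ∈ [1, Host.τfirst]` and every `x` (Kato's small-data theory for long times,
Leray's short-time bound for short times: `exists_classical_run_norm_le_two_mul_Icc`).
[cite: Kato1984, Thm. 2–4] [cite: Leray1934, §19 (3.8) p. 223 and §21 (3.15) p. 226] -/
theorem exists_levelZeroData_tame_freeRun :
    ∃ U : EuclideanSpace ℝ (Fin 3) → EuclideanSpace ℝ (Fin 3), LevelZeroData U 7 ∧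
      ∃ (v : ℝ → EuclideanSpace ℝ (Fin 3) → EuclideanSpace ℝ (Fin 3))
        (q : ℝ → EuclideanSpace ℝ (Fin 3) → ℝ),
        IsClassicalNSSolutionOn (Icc 1 Host.τfirst) 1 0 v q ∧ v 1 = U ∧
        (∃ C : ℝ≥0∞, C < ⊤ ∧ ∀ t ∈ Icc (1 : ℝ) Host.τfirst, ∫⁻ x, ‖v t x‖ₑ ^ 2 ≤ C) ∧
        ∀ t ∈ Icc (1 : ℝ) Host.τfirst, ∀ x, ‖v t x‖ ≤ 2 * TowerRates.wide.Y 0 := by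
  obtain ⟨c, hc, hrun⟩ := exists_classical_run_norm_le_two_mul_Icc
  obtain ⟨U, hLZ, hsm, hcs, hdiv, hceil, hL3⟩ := exists_levelZeroData_small (c * 1) (by rwa [mul_one])
  obtain ⟨v, q, hv, hv1, hE, hbd⟩ :=
    hrun one_pos one_lt_τfirst hsm hcs hdiv Host.wide_Y_zero_pos hceil hL3
  exact ⟨U, hLZ, v, q, hv, hv1, hE, hbd⟩

/-- `2 Y₀ ≤ (5/3) Y₁ − η` for every `η ≤ Y₁/3` (`2Y₀ ≤ Y₁`, `TowerRates.wide_sep`). [folklore] -/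
theorem two_mul_Y_zero_le_cap {η : ℝ} (hη : η ≤ TowerRates.wide.Y 1 / 3) :
    2 * TowerRates.wide.Y 0 ≤ 5 / 3 * TowerRates.wide.Y 1 - η := by
  have hsep : 2 * TowerRates.wide.Y 0 ≤ TowerRates.wide.Y (0 + 1) := TowerRates.wide_sep 0
  rw [zero_add] at hsep
  have hY := Host.wide_Y_zero_pos
  linarith

/-- **THE TAME CARRIER RUN UNDER THE DOOR'S CAP.** For every margin `η ≤ Y₁/3` there is a strict-slot
carrier `U` (`LevelZeroData U 7`) with a classical finite-energy free run `(v, q)` on `[1, Host.τfirst]`,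
`v 1 = U`, staying below `(5/3) Y₁ − η` — the carrier hypotheses `(h₁, hv₁, hv₁1, hv₁E, hcap₁)` of the
superposition door `palasekTowerBreakdown_episodeBase_of_superposed_freeRuns`, inhabited.
[cite: Kato1984, Thm. 2–4] [cite: Palasek2026ElementaryModel, §3.3] -/
theorem exists_levelZeroData_tame_freeRun_cap {η : ℝ} (hη : η ≤ TowerRates.wide.Y 1 / 3) :
    ∃ U : EuclideanSpace ℝ (Fin 3) → EuclideanSpace ℝ (Fin 3), LevelZeroData U 7 ∧
      ∃ (v : ℝ → EuclideanSpace ℝ (Fin 3) → EuclideanSpace ℝ (Fin 3))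
        (q : ℝ → EuclideanSpace ℝ (Fin 3) → ℝ),
        IsClassicalNSSolutionOn (Icc 1 Host.τfirst) 1 0 v q ∧ v 1 = U ∧
        (∃ C : ℝ≥0∞, C < ⊤ ∧ ∀ t ∈ Icc (1 : ℝ) Host.τfirst, ∫⁻ x, ‖v t x‖ₑ ^ 2 ≤ C) ∧
        ∀ t ∈ Icc (1 : ℝ) Host.τfirst, ∀ x, ‖v t x‖ ≤ 5 / 3 * TowerRates.wide.Y 1 - η := by
  obtain ⟨U, hLZ, v, q, hv, hv1, hE, hbd⟩ := exists_levelZeroData_tame_freeRun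
  exact ⟨U, hLZ, v, q, hv, hv1, hE, fun t ht x => (hbd t ht x).trans (two_mul_Y_zero_le_cap hη)⟩

/-- **The margin of an amplifier run is at most `Y₁/3`**: a field showing speed `≥ Y₁ + η` somewhere while
staying `≤ (5/3) Y₁ − η` there has `η ≤ Y₁/3`. [folklore] -/
theorem margin_le_third {η : ℝ} {w : EuclideanSpace ℝ (Fin 3) → EuclideanSpace ℝ (Fin 3)}
    (hspeed : ∃ x, TowerRates.wide.Y 1 + η ≤ ‖w x‖)
    (hcap : ∀ x, ‖w x‖ ≤ 5 / 3 * TowerRates.wide.Y 1 - η) : η ≤ TowerRates.wide.Y 1 / 3 := by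
  obtain ⟨x, hx⟩ := hspeed
  have := hcap x
  linarith

end Summit.NavierStokesRegularity.FluidComputer.PalasekTowerClayBridge.Germ

end
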